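import Summits.HodgeConjecture.HodgeConjecture.Theorems.Ring2HypothesesDescentFibreClassRetracts
import HarnessLib

/-!
# Ring 2 hypotheses, descent face — THE FIBRE-CLASS LEFSCHETZ NODE (β′) DESCENDS ALONG DOMINANT `S`-MORPHISMS OF COMPACT
# PENCILS OF THE SAME RELATIVE DIMENSION (fibrewise isogenies), with EXACT scalars; (β′) is an invariant of the
# `S`-isogeny class of a compact pencil of abelian varieties

research route conditional on HC_CM; not a corollary; Q11.4-sentence-2 already refuted in dim ≥ 3.
Cell `pub-hodge-ring2` (Hodge ladder STAGE 3), seat `ring2-b05` (binder row b05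
`Ring2.Hypotheses.MotivatedImpliesAlgebraicAV`, published modulo X = `Ring2.AbelianAll.LefschetzBCompactPencils`), gen 44,
second file (companion of `Ring2HypothesesDescentFibreClassRetracts`). `HC_CM` (`Theses.RankFourFaces.CMAbelianHodge`) occurs
ONLY as the displayed binder `hCM` of the last row, never restated; nothing here proves a case of the Hodge conjecture; no
binder is discharged; the β-nodes `FibreClassLefschetzOn`, `(β′)_d` stay OPEN and are displayed as hypotheses only.

THE OBSERVATION. ab-andre-2 XXXIII-e showed that TRANSPORT and the LIFT descend along every surjective `S`-morphism
`ψ : 𝒳 ⟶ 𝒳'` of smooth projective families of the same relative dimension (source pencil `ψ ≫ f'`, target `f'`). The same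
holds for the fibre-class Lefschetz node (β′_f) of the André axis — an EXACT operator identity, so the scalars must be
pinned: given the algebraic correspondence `T'` of `𝒳` inverting `∪[𝒳_t]` on fibre restrictions, put

  `T := (c · D)⁻¹ · ψ_! ∘ T' ∘ ψ^*`,

where `ψ^*(j'_{t*} x) = c · j_{t*}(ψ_t^* x)` is the ONE base change of the first file (`c` independent of `t` by (φ),
`exists_map_fiberGysin_eq_smul_of_over`) and `ψ_! ψ^* = D · id`, `D ≠ 0`, is the degree trick for the surjective
equidimensional `ψ` (the tree's `exists_complexGysin_map_eq_smul_of_surjective`, Voisin I Rem. 7.29). Then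
`ψ^*(j'_{t*} j'^*_t W) = c · j_{t*} j_t^*(ψ^* W)`, so `u := T'(j_{t*} j_t^* ψ^* W)` has `j_s^* u = j_s^* ψ^* W` for every `s`
((β′) for the source); `ψ_!` maps classes dying on `𝒳_s` to classes dying on `𝒳'_s` (XXXIII-e
`map_fiberι_push_gysin_eq_zero`, one more clean base change whose scalar never matters), hence
`j'^*_s ψ_! u = j'^*_s ψ_! ψ^* W = D · j'^*_s W`, and `j'^*_s T(j'_{t*} j'^*_t W) = (cD)⁻¹ · c · D · j'^*_s W = j'^*_s W`.

* §1 **`fibreClassLefschetzOn_of_dominant` — (β′) for the source pencil `ψ ≫ f'` gives (β′) for the target `f'`**, for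
  every surjective `S`-morphism `ψ` of compact pencils of abelian `d`-folds (a fibrewise isogeny). FACT-FREE.
* §2 `fibreClassLefschetzOn_iff_of_isogenies` — (β′) is an INVARIANT OF THE `S`-ISOGENY CLASS (isogenies both ways);
  `fibreClassLefschetzOn_of_dominant_of_retract` — the two functorialities composed: a pencil dominated by an `S`-retract of a
  pencil satisfying (β′) satisfies (β′).
* §3 the cell row with a COFINAL set of β-rungs: `hodgeAbelianVarieties_of_HC_CM_of_frequently_fibreClassLefschetzOnAtRelDim`
  (`HC_CM` BY NAME as the displayed binder `hCM`, load-bearing; modulo Lemme 6.3.1 = c11 only).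

HONEST COLUMN. No definition, no named fact, no sorry. With the first file these are the functorialities of (β′) the tree
affords, matching ab-andre-2's for (L)/(4): content(𝒳') ≤ content(𝒳) for `𝒳 ↠ 𝒳'` over `S` equidimensional, and
content(𝒳) ≤ content(𝒴) for `𝒳` an `S`-retract of `𝒴`. NOT claimed: the converse of §1 without an isogeny back (`ψ^* ψ_!` is
not a scalar), (β′) for any new pencil, descent along finite étale base change of the curve.
References: Abdulali1994FamiliesAV (Conj. 5.3, Thm. 5.5 p. 1130); Andre1996Motifs (§5.1 p. 25, §6.3 Remarque 2 p. 33);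
VoisinHodgeI2002 (§7.3.2 Lemma 7.28, Remark 7.29); Fulton1998 (Thm. 6.2 (a), Prop. 1.7, §16.1, Example 1.7.4); MumfordAV
(§18–19: isogenies of abelian schemes).
-/

noncomputable section

-- every declaration of this problem lives in `Summit.HodgeConjecture.HodgeConjecture.…` (summit = sub-problem)
set_option linter.dupNamespace false

open CategoryTheory CategoryTheory.Limits AlgebraicGeometry MonoidalCategory CartesianMonoidalCategory
open Literature.AlgebraicGeometry Literature.AlgebraicGeometry.Motives Literature.AlgebraicGeometry.HodgeTheory
open Literature.AlgebraicTopology.SingularHomology (singularCohomology)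
open Summit.HodgeConjecture.HodgeConjecture.Ring2.AbelianAll

namespace Summit.HodgeConjecture.HodgeConjecture.Theorems

variable {d : ℕ} {𝒳 𝒳' 𝒴 S : SchemeOver ℂ} {f' : 𝒳' ⟶ S} {ψ : 𝒳 ⟶ 𝒳'}

/-! ## §1 (β′) descends along dominant `S`-morphisms of compact pencils of the same relative dimension -/

/-- **(β′) DESCENDS ALONG FIBREWISE ISOGENIES.** Let `ψ : 𝒳 ⟶ 𝒳'` be a surjective `S`-morphism between compact pencils
`ψ ≫ f' : 𝒳 ⟶ S` and `f' : 𝒳' ⟶ S` of abelian `d`-folds. If `FibreClassLefschetzOn` holds for the source pencil `ψ ≫ f'`,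
it holds for the target `f'`: `T := (c · D)⁻¹ · ψ_! ∘ T' ∘ ψ^*` with `ψ^* j'_{t*} = c · j_{t*} ψ_t^*` (the one base change, `c`
independent of `t` by (φ)) and `ψ_! ψ^* = D · id`, `D ≠ 0` (degree trick); `ψ^*`, `ψ_!`, composites and scalar multiples
of algebraic correspondences are algebraic correspondences. No named fact. [cite: Abdulali1994FamiliesAV, Conjecture 5.3 and Theorem 5.5 (p. 1130)]
[cite: VoisinHodgeI2002, §7.3.2 Lemma 7.28 and Remark 7.29] [cite: Fulton1998, Thm. 6.2 (a) and §16.1 Prop. 16.1.1] -/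
theorem fibreClassLefschetzOn_of_dominant (hf : IsCompactAbelianPencil (ψ ≫ f') d) (hf' : IsCompactAbelianPencil f' d)
    [Surjective ψ.left] (h : FibreClassLefschetzOn hf) : FibreClassLefschetzOn hf' := by
  haveI : IsProper S.hom := IsSmoothProjective.isProper_holds hf'.isSmoothProjective_base
  have hPD : complexOrientationFamily.HasPoincareDuality := hasPoincareDuality_complexOrientationFamily
  -- the one base change `ψ^* j'_{t*} = c · j_{t*} ψ_t^*`, one scalar for all fibres
  obtain ⟨c, hc⟩ := exists_map_fiberGysin_eq_smul_of_over hf' hf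
  -- the degree trick `ψ_! ψ^* = D · id`, `D ≠ 0`
  obtain ⟨D, hD0, hD⟩ := exists_complexGysin_map_eq_smul_of_surjective complexOrientationFamily
    hf.isSmoothProjective_total hf'.isSmoothProjective_total ψ
  -- `c ≠ 0`: `ψ^*[𝒳'_t] = c · [𝒳_t]` and `ψ_! ψ^*[𝒳'_t] = D · [𝒳'_t] ≠ 0`
  have hc0 : c ≠ 0 := by
    haveI := connectedSpace_complexPoints hf'.isSmoothProjective_base
    obtain ⟨t⟩ : Nonempty (ComplexPoints S) := inferInstance
    intro h0
    apply fiberGysin_one_ne_zero hf' t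
    have h1 := hc t 0 (singularCohomology.one ℂ _)
    rw [h0, zero_smul] at h1
    have h2 := hD (2 * (0 + 1)) (by omega) (fiberGysin hf' t 0 (singularCohomology.one ℂ _))
    rw [h1, map_zero] at h2
    exact (smul_eq_zero.1 h2.symm).resolve_left hD0
  intro p hp
  obtain ⟨T', hT'alg, hT'id⟩ := h p hp
  refine ⟨(c * D)⁻¹ • (complexGysin complexOrientationFamily hf.isSmoothProjective_total hf'.isSmoothProjective_total ψ
      (show 2 * p + 2 * (d + 1) = 2 * p + 2 * (d + 1) from rfl) ∘ₗ T' ∘ₗ (complexBetti.map ψ (2 * (p + 1))).hom), ?_,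
    fun W t s ↦ ?_⟩
  · -- algebraicity
    refine IsAlgebraicCorrespondence.smul hf'.isSmoothProjective_total hf'.isSmoothProjective_total ?_ _
    refine IsAlgebraicCorrespondence.comp hf'.isSmoothProjective_total hf.isSmoothProjective_total
      hf'.isSmoothProjective_total ?_ (isAlgebraicCorrespondence_complexGysin complexOrientationFamily hPD
        hf.isSmoothProjective_total hf'.isSmoothProjective_total ψ _ (show 2 * p + (2 * (d + 1) - 2 * p) = 2 * (d + 1) by omega))
      (by omega)
    exact IsAlgebraicCorrespondence.comp hf.isSmoothProjective_total hf.isSmoothProjective_total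
      hf'.isSmoothProjective_total (isAlgebraicCorrespondence_map hf.isSmoothProjective_total hf'.isSmoothProjective_total
        ψ (by omega)) hT'alg (by omega)
  · -- `ψ^* (j'_{t*} j'^*_t W) = c · j_{t*} j_t^* (ψ^* W)`
    have h1 : complexBetti.map ψ (2 * (p + 1)) (fiberGysin hf' t p (complexBetti.map (fiberι f' t) (2 * p) W)) =
        c • fiberGysin hf t p (complexBetti.map (fiberι (ψ ≫ f') t) (2 * p) (complexBetti.map ψ (2 * p) W)) := by
      rw [hc t p, ← complexBetti.map_comp_apply' (fiberOverMap ψ f' t) (fiberι f' t), fiberOverMap_comp_fiberι,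
        complexBetti.map_comp_apply' (fiberι (ψ ≫ f') t) ψ]
    -- `u := T'(j_{t*} j_t^* ψ^* W)` and `ψ^* W` agree on `𝒳_s`, so `ψ_! u` and `ψ_! ψ^* W = D · W` agree on `𝒳'_s`
    have h2 : complexBetti.map (fiberι f' s) (2 * p)
        (complexGysin complexOrientationFamily hf.isSmoothProjective_total hf'.isSmoothProjective_total ψ
          (show 2 * p + 2 * (d + 1) = 2 * p + 2 * (d + 1) from rfl)
          (T' (fiberGysin hf t p (complexBetti.map (fiberι (ψ ≫ f') t) (2 * p) (complexBetti.map ψ (2 * p) W))) -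
            complexBetti.map ψ (2 * p) W)) = 0 :=
      map_fiberι_push_gysin_eq_zero complexOrientationFamily hf.isSmoothProjective_total hf'.isSmoothProjective_total
        hf.isSmoothProjectiveFamily hf'.isSmoothProjectiveFamily s _ (by rw [map_sub, hT'id, sub_self])
    rw [map_sub, map_sub, sub_eq_zero, hD] at h2
    change complexBetti.map (fiberι f' s) (2 * p) ((c * D)⁻¹ •
      complexGysin complexOrientationFamily hf.isSmoothProjective_total hf'.isSmoothProjective_total ψ _
        (T' (complexBetti.map ψ (2 * (p + 1)) (fiberGysin hf' t p (complexBetti.map (fiberι f' t) (2 * p) W))))) = _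
    rw [map_smul, h1, map_smul, map_smul, map_smul, h2, map_smul, smul_smul, smul_smul, mul_assoc,
      inv_mul_cancel₀ (mul_ne_zero hc0 hD0), one_smul]

/-! ## §2 (β′) is an invariant of the `S`-isogeny class; the two functorialities composed -/

/-- **(β′) IS AN INVARIANT OF THE `S`-ISOGENY CLASS of a compact pencil of abelian varieties**: given surjective
`S`-morphisms `ψ : 𝒳 ⟶ 𝒳'` and `ψ' : 𝒳' ⟶ 𝒳` of compact pencils of abelian `d`-folds (`ψ ≫ f' = f`, `ψ' ≫ f = f'`; e.g. an
isogeny and one in the opposite direction), `FibreClassLefschetzOn` holds for `f` iff it holds for `f'`. FACT-FREE.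
[cite: Abdulali1994FamiliesAV, Conjecture 5.3 (p. 1130)] [cite: VoisinHodgeI2002, §7.3.2 Remark 7.29] -/
theorem fibreClassLefschetzOn_iff_of_isogenies {f : 𝒳 ⟶ S} {ψ' : 𝒳' ⟶ 𝒳} (hf : IsCompactAbelianPencil f d)
    (hf' : IsCompactAbelianPencil f' d) (hψ : ψ ≫ f' = f) (hψ' : ψ' ≫ f = f') [Surjective ψ.left] [Surjective ψ'.left] :
    FibreClassLefschetzOn hf ↔ FibreClassLefschetzOn hf' := by
  constructor
  · intro h
    subst hψ
    exact fibreClassLefschetzOn_of_dominant hf hf' h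
  · intro h
    subst hψ'
    exact fibreClassLefschetzOn_of_dominant hf' hf h

/-- **The two functorialities composed**: if `f' : 𝒳' ⟶ S` (abelian `d`-folds) is dominated over `S` by `ψ : 𝒳 ⟶ 𝒳'`,
`ψ ≫ f'` a compact pencil of abelian `d`-folds which is an `S`-retract (`σ ≫ π = 𝟙`) of a compact pencil `π ≫ ψ ≫ f' : 𝒴 ⟶ S`
of abelian `d'`-folds, `d ≤ d'`, satisfying (β′), then `f'` satisfies (β′) (first file's `fibreClassLefschetzOn_of_retract`,
then §1). FACT-FREE. [cite: Abdulali1994FamiliesAV, Conjecture 5.3 (p. 1130)] [cite: Fulton1998, Thm. 6.2 (a) and §16.1] -/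
theorem fibreClassLefschetzOn_of_dominant_of_retract {d' : ℕ} {π : 𝒴 ⟶ 𝒳} {σ : 𝒳 ⟶ 𝒴}
    (hf : IsCompactAbelianPencil (ψ ≫ f') d) (hf' : IsCompactAbelianPencil f' d) [Surjective ψ.left]
    (hF : IsCompactAbelianPencil (π ≫ ψ ≫ f') d') (hσπ : σ ≫ π = 𝟙 𝒳) (hdd' : d ≤ d') (h : FibreClassLefschetzOn hF) :
    FibreClassLefschetzOn hf' :=
  fibreClassLefschetzOn_of_dominant hf hf' (fibreClassLefschetzOn_of_retract hf hF hσπ hdd' h)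

/-! ## §3 The cell row with a COFINAL set of β-rungs -/

/-- **`HC_CM ∧ [(β′)_d for a COFINAL set of d] ⟹ HC_AV` modulo Lemme 6.3.1 (c11)** (`HC_CM` BY NAME, load-bearing): by the
first file a cofinal set of rungs is ALL rungs (`fibreClassLefschetzOnCMPointedPencils_iff_frequently` — a node-level
statement, sharper than the row-level cofinality the tree had through `hcAtDim_mono`), then the André-axis row
`HC_AV_of_HC_CM_and_fibreClassLefschetzOnCMPointedPencils`. research route conditional on HC_CM; not a corollary;
Q11.4-sentence-2 already refuted in dim ≥ 3. [cite: Andre1996Motifs, Lemme 6.3.1 (p. 31) and Remarque 2 (p. 33)]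
[cite: Abdulali1994FamiliesAV, Conjecture 5.3, Theorem 5.5 and Lemma 6.2 (pp. 1130–1131)] -/
theorem hodgeAbelianVarieties_of_HC_CM_of_frequently_fibreClassLefschetzOnAtRelDim
    (h₂₁ : Literature.AlgebraicGeometry.Andre1996.andre1996_cmAnchoredPencil) (hCM : Theses.RankFourFaces.CMAbelianHodge)
    (hβ : ∀ N : ℕ, ∃ d, N ≤ d ∧ FibreClassLefschetzOnAtRelDim d) : Theses.PadicSemiregularLift.HodgeAbelianVarieties :=
  HC_AV_of_HC_CM_and_fibreClassLefschetzOnCMPointedPencils h₂₁ hCM (fibreClassLefschetzOnCMPointedPencils_iff_frequently.2 hβ)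

end Summit.HodgeConjecture.HodgeConjecture.Theorems

end
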